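import Summits.ResolutionOfSingularities.ResolutionOfSingularities.Theorems.MarkedTransferCampaignW24ReducedBridge
import Summits.ResolutionOfSingularities.ResolutionOfSingularities.Theorems.MarkedTransferCampaignW24Exhaust
import Summits.ResolutionOfSingularities.ResolutionOfSingularities.Theorems.MarkedTransferCampaignW24BottomStable
import Summits.ResolutionOfSingularities.ResolutionOfSingularities.Theorems.MarkedTransferCampaignW24ClaimsB
import Summits.ResolutionOfSingularities.ResolutionOfSingularities.Theorems.MarkedTransferCampaignW24ReducedRunUniversal
import Literature.RingTheory.MvPowerSeries.HasseDerivExactOrder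
import HarnessLib

/-!
# The REDUCED ↔ MULTIVARIATE bridge, run level: data of `Φ G = x·G(x²)`, every legal run is `Φ ∘ canonRun`,
# and a reduced escape refutes `StaysInBox` (HIRONAKA-L, slot W2.4 / W2.4-β residual; cell `res-hironaka`; OURS kernel support)

**HONEST FRAMING.** Everything here is OURS (cell `res-hironaka`, slot W2.4 = L-47B-s1): kernel theorems connecting the
MULTIVARIATE legal run `CampaignW24.IsBottomRun` / `StaysInBox` (p503230 / p507038) with res-L1-k24's REDUCED MODEL
`ReducedRun.canonRun` (p508772 / p509286). Nothing below is a statement of H. Hironaka's manuscript [Hironaka2017] (lit key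
`paper:url-3343fd9e678b`); the manuscript stays «under review» (D-0012/D-0089). AI work, weaker than expert review.

## What is proved (p = 2, e = 1, n = 1; `Φ G := x·G(x²)`, `Ψ G := G(x²)`; depth `ℓ ≥ 1`, `P = 2^{ℓ−1}`, `k = ord G`)

* §4 datum analysis: EVERY standard-expression datum of `Φ G` (`G ≠ 0`) of depth `ℓ` with non-empty top block has
  `α = e₀`, `β = 0`, `γ_* = k·e₀`, `DepthBox ⟺ k < P`; in the class `SoleBottom`, `u_* = Ψ (unitPart P k G)` (class
  isolation) and a legal inverse is `Ψ ((unitPart P k G)⁻¹)`; no Case (II) witness exists and, for `k ≥ 2`, no Case (III)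
  witness, so for ANY case witness `stepAt X w c = Φ (canonStepI P G)` (`stepAt_eq_phi_canonStepI`); `Φ G ≠ 0` is never
  of lower class relative to a datum of a `Φ G₀`.
* §5 run level: under a REDUCED ESCAPE at stage `i₁` (states `canonRun P G₀ i ≠ 0` of order `≥ 2` for `i < i₁`, state
  `i₁` non-zero of order `≥ P`) every legal depth-`ℓ` run from `Φ G₀` has length `≤ i₁` and IS `Φ ∘ canonRun P G₀`
  (`run_eq_phi_canonRun`), none reaches lower class, and — via `exhausts_of_staysInBox` (p508885) — `¬ StaysInBox 2 1 ℓ X₀`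
  (`not_staysInBox_of_escape`). CONSUMER: `MarkedTransferCampaignW24SomeDepthRefutation.lean` (with res-type-058's escape).
  Written by res-D-pv-020 AS res-L1-s24b-pv-1. Standard axioms only.
-/

noncomputable section
set_option linter.dupNamespace false -- mandated namespace of this single-conjunct summit

namespace Summit.ResolutionOfSingularities.ResolutionOfSingularities.Theorems

namespace CampaignW24

namespace ReducedBridge

open Literature.AlgebraicGeometry.Hironaka2017.S08UnitMonomial (StandardExpression)
open Literature.AlgebraicGeometry.Hironaka2017.S09LLUED
open Literature.AlgebraicGeometry.Hironaka2017.S09LLUED.TopFrontier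
open Literature.AlgebraicGeometry.Hironaka2017.S09LLUED.FrontierDrop (expo)
open Literature.AlgebraicGeometry.Hironaka2017.S09LLUED.TopDeriv
open Literature.AlgebraicGeometry.Resolution (adicOrder)
open Literature.RingTheory.MvPowerSeries (hasseDeriv coeff_hasseDeriv IsSupportedOnMultiples adicOrder_eq_order)
open CampaignW21 (xs hasseD)

variable {K : Type} [Field K]

/-! ## §4 Datum analysis for `Φ G` (`p = 2`, `e = 1`, `n = 1`) -/

section Datum

variable [CharP K 2] {ℓ : ℕ} {F : MvPowerSeries (Fin 1) K} {G : PowerSeries K}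

/-- Every datum of `Φ G` with non-empty top block has top pair `(e₀, 0)`. [folklore] -/
theorem alpha_eq_single (X : StandardExpression 2 (xs K 1) 1 ℓ F) (hF : F = phi G) (hℓ : 1 ≤ ℓ)
    (h0 : 0 < frontierLength X.support X.u) :
    alpha X.support X.u = Finsupp.single 0 1 ∧ beta X.support X.u = 0 := by
  subst hF
  have hts := (mem_effSupport.mp (mem_topBlock.mp (bot_mem X h0)).1).1
  have hβ : beta X.support X.u = 0 := by
    rw [eq_single (beta X.support X.u)]
    have := X.b_lt _ hts 0
    simp only [Nat.sub_self, pow_zero, Nat.lt_one_iff] at this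
    rw [this, Finsupp.single_zero]
  have hc := coeff_bottomExp_ne_zero X Nat.one_pos hℓ h0
  rw [coeff_phi] at hc
  split_ifs at hc with h2
  · exact absurd rfl hc
  · refine ⟨?_, hβ⟩
    have ha : alpha X.support X.u 0 < 2 := X.a_lt _ hts 0
    simp only [bottomExp, hβ, smul_zero, add_zero, Finsupp.add_apply, Finsupp.smul_apply, smul_eq_mul] at h2
    rw [eq_single (alpha X.support X.u)]
    congr 1
    omega

/-- Every datum of `Φ G` (`ord G = k`) with non-empty top block has bottom exponent `γ_* = k·e₀`. [folklore] -/
theorem gammaStar_eq_single (X : StandardExpression 2 (xs K 1) 1 ℓ F) (hF : F = phi G) (hℓ : 1 ≤ ℓ)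
    (h0 : 0 < frontierLength X.support X.u) {k : ℕ} (hk : PowerSeries.order G = k) :
    gammaStar X.support X.u = Finsupp.single 0 k := by
  obtain ⟨hα, hβ⟩ := alpha_eq_single X hF hℓ h0
  subst hF
  obtain ⟨hk0, hklt⟩ := PowerSeries.order_eq_nat.mp hk
  -- `k ≤ γ_* 0`: the bottom coefficient is `coeff_{γ_* 0} G ≠ 0`
  have hc := coeff_bottomExp_ne_zero X Nat.one_pos hℓ h0
  have hbot : bottomExp 2 1 X.support X.u = Finsupp.single 0 (2 * gammaStar X.support X.u 0 + 1) := by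
    rw [bottomExp, hα, hβ, eq_single (gammaStar X.support X.u)]
    refine Finsupp.ext fun s => ?_
    have hs : s = 0 := Subsingleton.elim _ _
    subst hs
    simp only [Finsupp.add_apply, Finsupp.smul_apply, Finsupp.single_eq_same, smul_eq_mul, smul_zero,
      Finsupp.coe_zero, Pi.zero_apply]
    omega
  rw [hbot, coeff_phi_two_mul_add_one] at hc
  have h1 : k ≤ gammaStar X.support X.u 0 := by
    by_contra hlt
    exact hc (hklt _ (by omega))
  -- `γ_* ≤lex k·e₀`: the monomial `x^{2k+1}` is visible
  have h2 := toLex_gammaStar_le_of_coeff_ne_zero X Nat.one_pos hℓ h0 (c := Finsupp.single 0 k) (by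
    have : topFrontierExp 2 X.support X.u + 2 ^ 1 • Finsupp.single 0 k = Finsupp.single 0 (2 * k + 1) := by
      rw [topFrontierExp, hα, hβ]
      refine Finsupp.ext fun s => ?_
      have hs : s = 0 := Subsingleton.elim _ _
      subst hs
      simp only [Finsupp.add_apply, Finsupp.smul_apply, Finsupp.single_eq_same, smul_eq_mul, smul_zero,
        Finsupp.coe_zero, Pi.zero_apply]
      omega
    rw [this, coeff_phi_two_mul_add_one]
    exact hk0)
  have h3 : Finsupp.single 0 k ≤ gammaStar X.support X.u := by
    intro s
    have hs : s = 0 := Subsingleton.elim _ _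
    subst hs
    simpa using h1
  have h4 : toLex (Finsupp.single (0 : Fin 1) k) = toLex (gammaStar X.support X.u) :=
    le_antisymm (Finsupp.toLex_monotone h3) h2
  exact (toLex_inj.mp h4).symm

/-- For a datum of `Φ G` (`ord G = k`): `DepthBox ⟺ k < 2^{ℓ−1}`. [folklore] -/
theorem depthBox_iff (X : StandardExpression 2 (xs K 1) 1 ℓ F) (hF : F = phi G) (hℓ : 1 ≤ ℓ)
    (h0 : 0 < frontierLength X.support X.u) {k : ℕ} (hk : PowerSeries.order G = k) :
    DepthBox 2 1 ℓ X.support X.u ↔ k < 2 ^ (ℓ - 1) := by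
  rw [DepthBox, gammaStar_eq_single X hF hℓ h0 hk]
  have h2 : 2 ^ ℓ = 2 * 2 ^ (ℓ - 1) := by
    rw [← pow_succ', Nat.sub_add_cancel hℓ]
  constructor
  · intro h
    have := h 0
    simp only [Finsupp.smul_apply, Finsupp.single_eq_same, smul_eq_mul, pow_one] at this
    omega
  · intro h s
    have hs : s = 0 := Subsingleton.elim _ _
    subst hs
    simp only [Finsupp.smul_apply, Finsupp.single_eq_same, smul_eq_mul, pow_one]
    omega

/-- For a datum of `Φ G` in `SoleBottom` (`ord G = k`, depth `ℓ ≥ 1`): `u_* = Ψ (unitPart 2^{ℓ−1} k G)`. [folklore] -/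
theorem uStar_eq_psi_unitPart (X : StandardExpression 2 (xs K 1) 1 ℓ F) (hF : F = phi G) (hℓ : 1 ≤ ℓ)
    (h0 : 0 < frontierLength X.support X.u) {k : ℕ} (hk : PowerSeries.order G = k)
    (hsole : SoleBottom 2 1 ℓ X.support X.u) :
    uStar X.support X.u = psi (ReducedRun.unitPart (2 ^ (ℓ - 1)) k G) := by
  obtain ⟨hα, hβ⟩ := alpha_eq_single X hF hℓ h0
  have hγ := gammaStar_eq_single X hF hℓ h0 hk
  subst hF
  have h2 : 2 ^ ℓ = 2 * 2 ^ (ℓ - 1) := by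
    rw [← pow_succ', Nat.sub_add_cancel hℓ]
  ext d
  by_cases hd : 2 ^ ℓ ∣ d 0
  · obtain ⟨m, hm⟩ := hd
    have hdμ : d = 2 ^ ℓ • Finsupp.single 0 m := by
      rw [eq_single d, hm, Finsupp.smul_single, smul_eq_mul]
    have h1 := coeff_bottomExp_add_eq_coeff_uStar X Nat.one_pos hℓ h0 hsole (Finsupp.single 0 m)
    rw [← hdμ] at h1
    rw [← h1]
    have h3 : bottomExp 2 1 X.support X.u + d = Finsupp.single 0 (2 * (2 ^ (ℓ - 1) * m + k) + 1) := by
      rw [bottomExp, hα, hβ, hγ, eq_single d, hm, h2]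
      refine Finsupp.ext fun s => ?_
      have hs : s = 0 := Subsingleton.elim _ _
      subst hs
      simp only [Finsupp.add_apply, Finsupp.smul_apply, Finsupp.single_eq_same, smul_eq_mul, smul_zero,
        Finsupp.coe_zero, Pi.zero_apply, pow_one]
      ring
    have h4 : d = Finsupp.single 0 (2 * (2 ^ (ℓ - 1) * m)) := by
      rw [eq_single d, hm, h2, mul_assoc]
    rw [h3, coeff_phi_two_mul_add_one, h4, coeff_psi_two_mul, ReducedRun.coeff_unitPart,
      if_pos (dvd_mul_right _ _)]
  · rw [coeff_uStar_eq_zero_of_not_dvd X h0 ⟨0, hd⟩, coeff_psi]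
    split_ifs with h2d
    · obtain ⟨m, hm⟩ := h2d
      rw [hm, Nat.mul_div_cancel_left _ Nat.two_pos, ReducedRun.coeff_unitPart, if_neg]
      intro hPm
      apply hd
      rw [hm, h2]
      exact Nat.mul_dvd_mul_left 2 hPm
    · rfl

/-- A legal inverse of `u_*` on a datum of `Φ G` in `SoleBottom` is `Ψ ((unitPart …)⁻¹)`. [folklore] -/
theorem eq_psi_inv_unitPart (X : StandardExpression 2 (xs K 1) 1 ℓ F) (hF : F = phi G) (hℓ : 1 ≤ ℓ)
    (h0 : 0 < frontierLength X.support X.u) {k : ℕ} (hk : PowerSeries.order G = k)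
    (hsole : SoleBottom 2 1 ℓ X.support X.u) {w : MvPowerSeries (Fin 1) K} (hw : w * uStar X.support X.u = 1) :
    w = psi (ReducedRun.unitPart (2 ^ (ℓ - 1)) k G)⁻¹ := by
  set u := ReducedRun.unitPart (2 ^ (ℓ - 1)) k G with hu
  have hu0 : PowerSeries.constantCoeff u ≠ 0 := by
    rw [hu, ReducedRun.constantCoeff_unitPart]
    exact (PowerSeries.order_eq_nat.mp hk).1
  have hinv : psi u * psi u⁻¹ = 1 := by
    rw [← map_mul, PowerSeries.mul_inv_cancel u hu0, map_one]
  rw [uStar_eq_psi_unitPart X hF hℓ h0 hk hsole] at hw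
  calc w = w * (psi u * psi u⁻¹) := by rw [hinv, mul_one]
    _ = psi u⁻¹ := by rw [← mul_assoc, hw, one_mul]

/-- No Case (II) witness on a datum of `Φ G` (`|α + pβ| = 1 ≯ 2`). [folklore] -/
theorem not_isCaseII : ¬ IsCaseII 2 (2 ^ 1) (Finsupp.single (0 : Fin 1) 1) 0 := by
  intro h
  simp only [IsCaseII, smul_zero, add_zero, Finsupp.degree_single] at h
  omega

/-- No Case (III) witness when the bottom digit is `k ≥ 2`: `|γ_*| = k ≠ 1`. [folklore] -/
theorem not_isCaseIII {k : ℕ} (hk : 2 ≤ k) : ¬ IsCaseIII 2 (2 ^ 1) (Finsupp.single (0 : Fin 1) 1) 0 (Finsupp.single 0 k) := by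
  intro h
  have := h.2.2.2
  rw [Finsupp.degree_single] at this
  omega

/-- The case-indexed operator IS the Case-(I) operator when no Case (II)/(III) witness exists. [folklore] -/
theorem op_eq_opI {R : Type} [CommRing R] {n : ℕ} (x : Fin n → R) (D : (Fin n →₀ ℕ) → R → R) (w : R) (p q : ℕ)
    (α β γ : Fin n →₀ ℕ) (c : HFlat.Case p q α β γ) (hII : ¬ IsCaseII p q α β) (hIII : ¬ IsCaseIII p q α β γ) :
    op x D w p q α β γ c = opI D w p q α β γ := by
  cases c with
  | I h => rfl
  | II h => exact absurd h hII
  | III h => exact absurd h hIII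

/-- **Step bridge, operator form** (no case witness): `F − opI(w; e₀, 0, k·e₀) F = Φ (canonStepI 2^{ℓ−1} G)` on a datum of
`F = Φ G` in `SoleBottom` with `w·u_* = 1`, `k = ord G`. [folklore] -/
theorem sub_opI_eq_phi_canonStepI (X : StandardExpression 2 (xs K 1) 1 ℓ F) (hF : F = phi G) (hℓ : 1 ≤ ℓ)
    (h0 : 0 < frontierLength X.support X.u) {k : ℕ} (hk : PowerSeries.order G = k)
    (hsole : SoleBottom 2 1 ℓ X.support X.u) {w : MvPowerSeries (Fin 1) K} (hw : w * uStar X.support X.u = 1) :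
    F - opI (hasseD K 1) w 2 (2 ^ 1) (Finsupp.single 0 1) 0 (Finsupp.single 0 k) F =
      phi (ReducedRun.canonStepI (2 ^ (ℓ - 1)) G) := by
  have hwinv := eq_psi_inv_unitPart X hF hℓ h0 hk hsole hw
  subst hF
  have hkn : (PowerSeries.order G).toNat = k := by rw [hk]; rfl
  rw [opI, HFlat.pre, ReducedRun.canonStepI, hkn, ReducedRun.stepI, phi_sub, phi_mul, phi_mul, hwinv,
    ← hasseD_one_phi G, ← hasseD_two_mul_phi G k]
  congr 3
  · rw [smul_zero, add_zero]
  · rw [Finsupp.smul_single, smul_eq_mul, pow_one]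

/-- **Step bridge.** On a datum of `Φ G` in `SoleBottom` with `w·u_* = 1`, bottom digit `k = ord G ≥ 2`, and ANY case
witness `c`, the multivariate step `stepAt` is `Φ` of k24's canonical reduced Case-(I) step at `P = 2^{ℓ−1}`. [folklore] -/
theorem stepAt_eq_phi_canonStepI (X : StandardExpression 2 (xs K 1) 1 ℓ F) (hF : F = phi G) (hℓ : 1 ≤ ℓ)
    (h0 : 0 < frontierLength X.support X.u) {k : ℕ} (hk : PowerSeries.order G = k) (h2k : 2 ≤ k)
    (hsole : SoleBottom 2 1 ℓ X.support X.u) {w : MvPowerSeries (Fin 1) K} (hw : w * uStar X.support X.u = 1)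
    (c : HFlat.Case 2 (2 ^ 1) (alpha X.support X.u) (beta X.support X.u) (gammaStar X.support X.u)) :
    stepAt (xs K 1) (hasseD K 1) X w c = phi (ReducedRun.canonStepI (2 ^ (ℓ - 1)) G) := by
  obtain ⟨hα, hβ⟩ := alpha_eq_single X hF hℓ h0
  have hγ := gammaStar_eq_single X hF hℓ h0 hk
  have hII : ¬ IsCaseII 2 (2 ^ 1) (alpha X.support X.u) (beta X.support X.u) := by
    rw [hα, hβ]; exact not_isCaseII
  have hIII : ¬ IsCaseIII 2 (2 ^ 1) (alpha X.support X.u) (beta X.support X.u) (gammaStar X.support X.u) := by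
    rw [hα, hβ, hγ]; exact not_isCaseIII h2k
  have key := sub_opI_eq_phi_canonStepI X hF hℓ h0 hk hsole hw
  subst hF
  show phi G - op (xs K 1) (hasseD K 1) w 2 (2 ^ 1) _ _ _ c (phi G) = _
  rw [op_eq_opI _ _ _ _ _ _ _ _ c hII hIII, hα, hβ, hγ]
  exact key

/-- `Φ G`, `G ≠ 0`, is never of lower class relative to a datum `X₀` (non-empty top block, depth `ℓ₀ ≥ 1`) of a `Φ G₀`
(odd monomials vs. even residues of the summands strictly below the top pair `(e₀, 0)`). [folklore] -/
theorem not_isLowerClass_phi {ℓ₀ : ℕ} {F₀ : MvPowerSeries (Fin 1) K} {G₀ : PowerSeries K}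
    (X₀ : StandardExpression 2 (xs K 1) 1 ℓ₀ F₀) (hF₀ : F₀ = phi G₀) (hℓ₀ : 1 ≤ ℓ₀)
    (h00 : 0 < frontierLength X₀.support X₀.u) (hG : G ≠ 0) : ¬ IsLowerClass X₀ (phi G) := by
  intro hlow
  obtain ⟨hα, hβ⟩ := alpha_eq_single X₀ hF₀ hℓ₀ h00
  have hk : ∃ k, PowerSeries.coeff k G ≠ 0 := by
    by_contra h
    push Not at h
    exact hG (PowerSeries.ext fun k => by rw [h k, map_zero])
  obtain ⟨k, hk⟩ := hk
  have hm : MvPowerSeries.coeff (Finsupp.single 0 (2 * k + 1)) (phi G) ≠ 0 := by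
    rwa [coeff_phi_two_mul_add_one]
  obtain ⟨t, ht, -, hlt, hmod⟩ := hlow _ hm
  have hb : t.2.1 = 0 := by
    rw [eq_single t.2.1]
    have := X₀.b_lt _ ht 0
    simp only [Nat.sub_self, pow_zero, Nat.lt_one_iff] at this
    rw [this, Finsupp.single_zero]
  have ha : t.1 0 = 0 := by
    have ha2 : t.1 0 < 2 := X₀.a_lt _ ht 0
    by_contra h1
    have h1' : t.1 = Finsupp.single 0 1 := by
      rw [eq_single t.1]; congr 1; omega
    apply lt_irrefl (pairKey t)
    have : pairKey t = toLex (toLex (alpha X₀.support X₀.u), toLex (beta X₀.support X₀.u)) := by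
      rw [pairKey, h1', hb, hα, hβ]
    exact this ▸ hlt
  have h2 := hmod 0
  simp only [expo, Finsupp.add_apply, Finsupp.smul_apply, smul_eq_mul, ha, hb, Finsupp.coe_zero, Pi.zero_apply,
    mul_zero, zero_add, Finsupp.single_eq_same, pow_one, Nat.ModEq, Nat.mul_mod_right] at h2
  omega

end Datum

/-! ## §5 Run level: every legal run is `Φ ∘ canonRun`; a reduced escape refutes `StaysInBox` -/

section Run

variable [CharP K 2]

/-- **Run bridge.** If the reduced run `G_i := canonRun 2^{ℓ−1} G₀ i` ESCAPES at stage `i₁` (states `i < i₁` non-zero of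
order `≥ 2`, state `i₁` non-zero of order `≥ 2^{ℓ−1}`), EVERY legal depth-`ℓ` bottom-member run `εs` from `Φ G₀` (any data,
inverses, case witnesses) has `N ≤ i₁` and `εs i = Φ G_i` for all `i ≤ N`. [folklore] -/
theorem run_eq_phi_canonRun {ℓ : ℕ} (hℓ : 1 ≤ ℓ) {G₀ : PowerSeries K} {N : ℕ} {εs : ℕ → MvPowerSeries (Fin 1) K}
    (h0 : εs 0 = phi G₀) (hrun : IsBottomRun 2 1 ℓ εs N) {i₁ : ℕ}
    (hpre : ∀ i < i₁, ReducedRun.canonRun (2 ^ (ℓ - 1)) G₀ i ≠ 0 ∧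
      (2 : ℕ∞) ≤ PowerSeries.order (ReducedRun.canonRun (2 ^ (ℓ - 1)) G₀ i))
    (hesc : ReducedRun.canonRun (2 ^ (ℓ - 1)) G₀ i₁ ≠ 0 ∧
      ((2 ^ (ℓ - 1) : ℕ) : ℕ∞) ≤ PowerSeries.order (ReducedRun.canonRun (2 ^ (ℓ - 1)) G₀ i₁)) :
    ∀ i ≤ N, i ≤ i₁ ∧ εs i = phi (ReducedRun.canonRun (2 ^ (ℓ - 1)) G₀ i) := by
  intro i
  induction i with
  | zero => exact fun _ => ⟨Nat.zero_le _, h0⟩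
  | succ i ih =>
    intro hi
    obtain ⟨hii₁, hεi⟩ := ih (Nat.le_of_succ_le hi)
    obtain ⟨X, w, c, hX0, hsole, hbox, hw, hstep⟩ := hrun i hi
    have hfin_of : ∀ G : PowerSeries K, G ≠ 0 → PowerSeries.order G = ((PowerSeries.order G).toNat : ℕ∞) :=
      fun G hG => (ENat.coe_toNat fun h => hG (PowerSeries.order_eq_top.mp h)).symm
    rcases Nat.lt_or_ge i i₁ with hlt | hge
    · obtain ⟨hne, h2⟩ := hpre i hlt
      have hfin := hfin_of _ hne
      have h2k : 2 ≤ (PowerSeries.order (ReducedRun.canonRun (2 ^ (ℓ - 1)) G₀ i)).toNat := by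
        rw [hfin] at h2
        exact_mod_cast h2
      refine ⟨hlt, ?_⟩
      rw [hstep, stepAt_eq_phi_canonStepI X hεi hℓ hX0 hfin h2k hsole hw c]
      rfl
    · exfalso
      have heq : i = i₁ := le_antisymm hii₁ hge
      subst heq
      obtain ⟨hne, hP⟩ := hesc
      have hfin := hfin_of _ hne
      have hlt := (depthBox_iff X hεi hℓ hX0 hfin).mp hbox
      rw [hfin] at hP
      have hP' := ENat.coe_le_coe.mp hP
      omega

/-- **No legal run reaches lower class** under a reduced escape (`X₀` any datum of `Φ G₀`, depth `ℓ₀ ≥ 1`). [folklore] -/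
theorem not_isLowerClass_of_escape {ℓ₀ ℓ : ℕ} (hℓ : 1 ≤ ℓ) {G₀ : PowerSeries K} {F₀ : MvPowerSeries (Fin 1) K}
    (X₀ : StandardExpression 2 (xs K 1) 1 ℓ₀ F₀) (hF₀ : F₀ = phi G₀) (hℓ₀ : 1 ≤ ℓ₀)
    (h00 : 0 < frontierLength X₀.support X₀.u) {i₁ : ℕ}
    (hpre : ∀ i < i₁, ReducedRun.canonRun (2 ^ (ℓ - 1)) G₀ i ≠ 0 ∧
      (2 : ℕ∞) ≤ PowerSeries.order (ReducedRun.canonRun (2 ^ (ℓ - 1)) G₀ i))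
    (hesc : ReducedRun.canonRun (2 ^ (ℓ - 1)) G₀ i₁ ≠ 0 ∧
      ((2 ^ (ℓ - 1) : ℕ) : ℕ∞) ≤ PowerSeries.order (ReducedRun.canonRun (2 ^ (ℓ - 1)) G₀ i₁)) :
    ∀ (N : ℕ) (εs : ℕ → MvPowerSeries (Fin 1) K), εs 0 = phi G₀ → IsBottomRun 2 1 ℓ εs N →
      ¬ IsLowerClass X₀ (εs N) := by
  intro N εs h0 hrun
  obtain ⟨hN, hεN⟩ := run_eq_phi_canonRun hℓ h0 hrun hpre hesc N le_rfl
  rw [hεN]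
  refine not_isLowerClass_phi X₀ hF₀ hℓ₀ h00 ?_
  rcases Nat.lt_or_ge N i₁ with h | h
  · exact (hpre N h).1
  · rw [le_antisymm hN h]
    exact hesc.1

omit [CharP K 2] in
/-- `ord (Φ G) ≥ 3` when `G(0) = 0`. [folklore] -/
theorem three_le_order_phi {G : PowerSeries K} (hG0 : PowerSeries.constantCoeff G = 0) :
    (3 : ℕ∞) ≤ (phi G).order := by
  refine MvPowerSeries.nat_le_order fun d hd => ?_
  rw [coeff_phi]
  split_ifs with h2
  · rfl
  · have hdeg : d.degree = d 0 := by
      rw [eq_single d, Finsupp.degree_single, Finsupp.single_eq_same]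
    rw [hdeg] at hd
    have hd' : d 0 < 3 := by exact_mod_cast hd
    have h1 : d 0 / 2 = 0 := by omega
    rw [h1, PowerSeries.coeff_zero_eq_constantCoeff_apply]
    exact hG0

/-- **A reduced escape refutes box-confinement** (hypotheses of `run_eq_phi_canonRun`, depth `ℓ ≥ ℓ₀ ≥ 1`, `K` perfect,
`G₀(0) = 0`, `X₀` a reference datum of `Φ G₀` of depth `ℓ₀`): `¬ StaysInBox 2 1 ℓ X₀` — by `exhausts_of_staysInBox`
(p508885) a confined depth carries a legal run INTO lower class; by `not_isLowerClass_of_escape` none does. [folklore] -/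
theorem not_staysInBox_of_escape [ExpChar K 2] [PerfectRing K 2] {ℓ₀ ℓ : ℕ} (hℓ₀ : 1 ≤ ℓ₀) (hℓ : ℓ₀ ≤ ℓ)
    {G₀ : PowerSeries K} (hG₀0 : PowerSeries.constantCoeff G₀ = 0) {F₀ : MvPowerSeries (Fin 1) K}
    (X₀ : StandardExpression 2 (xs K 1) 1 ℓ₀ F₀) (hF₀ : F₀ = phi G₀) (h00 : 0 < frontierLength X₀.support X₀.u)
    {i₁ : ℕ}
    (hpre : ∀ i < i₁, ReducedRun.canonRun (2 ^ (ℓ - 1)) G₀ i ≠ 0 ∧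
      (2 : ℕ∞) ≤ PowerSeries.order (ReducedRun.canonRun (2 ^ (ℓ - 1)) G₀ i))
    (hesc : ReducedRun.canonRun (2 ^ (ℓ - 1)) G₀ i₁ ≠ 0 ∧
      ((2 ^ (ℓ - 1) : ℕ) : ℕ∞) ≤ PowerSeries.order (ReducedRun.canonRun (2 ^ (ℓ - 1)) G₀ i₁)) :
    ¬ StaysInBox 2 1 ℓ X₀ := by
  intro hstay
  haveI : PerfectField K := PerfectRing.toPerfectField K 2
  subst hF₀
  have hα : alpha X₀.support X₀.u ≠ 0 := by
    rw [(alpha_eq_single X₀ rfl hℓ₀ h00).1]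
    exact Finsupp.single_ne_zero.mpr one_ne_zero
  have hord : ((2 ^ 1 : ℕ) : ℕ∞) < adicOrder (phi G₀) := by
    rw [adicOrder_eq_order]
    exact lt_of_lt_of_le (by decide) (three_le_order_phi hG₀0)
  obtain ⟨N, εs, h0, hrun, hlow⟩ := exhausts_of_staysInBox X₀ Nat.one_pos hℓ₀ h00 hα hord hℓ hstay
  exact not_isLowerClass_of_escape (le_trans hℓ₀ hℓ) X₀ rfl hℓ₀ h00 hpre hesc N εs h0 hrun hlow

end Run

end ReducedBridge

end CampaignW24

end Summit.ResolutionOfSingularities.ResolutionOfSingularities.Theorems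

end
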